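import Summits.CriticalPhenomena.PercolationContinuityZ3.Theorems.PercNearOneGluingAdditiveGluingClusterPeelLoc
import HarnessLib

/-! # Crux `PercNearOneGluing.AdditiveGluing` (stmt-CriticalPhenomena-4576) — the THREE-RELAY case from ONE peeling inequality with the
# AG-loc residual bound and the additive budget: `(MU-loc)(3) ⇒ AdditiveGluing for |A| ≤ 3`

Support file (`--supports stmt-CriticalPhenomena-4576`, cell `prim-png-dp-al5` gen 5).  No definitions, no named facts, no sorries; the kernel is a HYPOTHESIS.

Context (seat memo LOCPEEL-g5.md §7, item evidence).  Three one-relay peeling kernels are now Lean reductions: (MU-E)/(MU-opt) (`…ClusterPeelMuE*`, budget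
`1 − min τ`, residual bounded by `AdditiveGluing` itself resp. + union bounds) and (LOC-peel) (`…ClusterPeelLoc*`, budget AND residual = AG-loc).  (LOC-peel) is FALSE
(exact 5-vertex witness, this seat: a weakly attached observer next to near-tied relays makes the AG-loc slack second-order small while peeling leaves a first-order
residual slack), whereas the HYBRID — additive budget `1 − min_A τ`, residual failure of `G − C(d)` bounded by the localised union bound AG-loc OF THE RESIDUAL PAIR — has
0 violations in every census and climb so far (≈ 100k exact instances incl. all (MU)/(MU-A)/(LOC-peel) witnesses; margin ≥ 0.92·σ′ on the twin anatomy where (MU-opt) keeps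
0.12·σ′).  For `|A| = 3` the residual relay sets have at most two elements, where AG-loc is the landed theorem `AGloc.agloc_firstRank_card_le_two`, so this kernel,
  (MU-loc)(3):  `∃ d ∈ A, ∃ residual ranks r_W:  μ(o↔d, d↮b) + μ(d↔b, d↮o, o↔A∖d) + Σ_{W∌o,b} μ(C(d)=W)·Λ^{r_W}_{G−W}(A∖W) + θ ≤ 1`   (`θ ≤ min_A τ`),
is a ONE-SHOT reduction of the three-relay case of the crux (Kozma–Nitzan's first open case): no induction is needed.
* `ClusterPeelMuLoc.agFail_card_three_of_muLoc` — (MU-loc)(3) ⇒ `μ(o ↔ A, o ↮ b) ≤ t` for `|A| ≤ 3`, `b ∉ A`.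
* `ClusterPeelMuLoc.additiveGluing_card_three_of_muLoc` — (MU-loc)(3) ⇒ `AdditiveGluing` for every relay set with `|A| ≤ 3`.
[cite: KozmaNitzan2024, §3.2 p. 12 (conditioning on C(0) = W), Thm. 1 pp. 7–8, Conj. 1 p. 3]
-/

namespace Summit.CriticalPhenomena.PercolationContinuityZ3.Theorems

open MeasureTheory Set
open Literature.Probability.LatticeModels (prodBernoulli)
open Literature.Probability.Percolation
open scoped BigOperators

noncomputable section
open Classical

namespace ClusterPeelMuLoc

open ClusterPeel ClusterPeelLoc

/-- **(MU-loc)(3) ⇒ the failure form for `|A| ≤ 3`.**  `|A| ≤ 2`: `ClusterPeel.agFail_card_le_two`; `o ∈ A`, `o = b`: immediate; `|A| = 3`: peel the relay `d` of the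
kernel (`ClusterPeel.peel_bound`) with the residual failure of `G − W = restrW Wᶜ w` bounded by the two-relay AG-loc `AGloc.agloc_firstRank_card_le_two` (`|A ∖ W| ≤ 2`).
[cite: KozmaNitzan2024, §3.2 p. 12, Thm. 1 pp. 7–8] -/
theorem agFail_card_three_of_muLoc
    (hML : ∀ (n : ℕ) (w : Sym2 (Fin n) → unitInterval) (A : Finset (Fin n)) (o b : Fin n) (θ : ℝ),
      o ∉ A → b ∉ A → o ≠ b → A.card = 3 → (∀ a ∈ A, θ ≤ (prodBernoulli w).real (openConn a b)) →
      ∃ d ∈ A, ∃ rW : Finset (Fin n) → (Fin n → ℕ),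
        (∀ W : Finset (Fin n), Set.InjOn (rW W) ↑(A \ W)) ∧
        (∀ W : Finset (Fin n), ∀ a ∈ A \ W, ∀ a' ∈ A \ W, rW W a < rW W a' →
          (prodBernoulli w).real (openConnIn ((↑W : Set (Fin n))ᶜ) a b) ≤ (prodBernoulli w).real (openConnIn ((↑W : Set (Fin n))ᶜ) a' b)) ∧
        (prodBernoulli w).real (openConn d o ∩ (openConn d b)ᶜ : Set (BondConfig (Fin n)))
          + (prodBernoulli w).real (openConn d b ∩ (openConn d o)ᶜ ∩ (⋃ a ∈ A.erase d, openConn o a))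
          + ∑ W ∈ Finset.univ.filter (fun W : Finset (Fin n) => o ∉ W ∧ b ∉ W),
              (prodBernoulli w).real (clusterIs d W) *
                ∑ a ∈ A \ W, (prodBernoulli w).real
                    (openConnIn ((↑W : Set (Fin n))ᶜ) o a ∩
                      ⋂ a' ∈ (A \ W).filter (fun a' => rW W a' < rW W a), (openConnIn ((↑W : Set (Fin n))ᶜ) o a')ᶜ) *
                  (1 - (prodBernoulli w).real (openConnIn ((↑W : Set (Fin n))ᶜ) a b))
          + θ ≤ 1)
    (n : ℕ) (w : Sym2 (Fin n) → unitInterval) (A : Finset (Fin n)) (o b : Fin n) (t : ℝ)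
    (hA : A.card ≤ 3) (hb : b ∉ A) (ht : 0 ≤ t) (hτ : ∀ a ∈ A, 1 - t ≤ (prodBernoulli w).real (openConn a b)) :
    (prodBernoulli w).real ((⋃ a ∈ A, openConn o a) ∩ (openConn o b)ᶜ) ≤ t := by
  set μ := prodBernoulli w with hμ
  have hmeas : ∀ E : Set (BondConfig (Fin n)), MeasurableSet E := fun E => MeasurableSet.of_discrete
  by_cases hA2 : A.card ≤ 2
  · exact agFail_card_le_two w A o b t hA2 ht hτ
  by_cases ho : o ∈ A
  · calc μ.real ((⋃ a ∈ A, openConn o a) ∩ (openConn o b)ᶜ)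
        ≤ μ.real ((openConn o b)ᶜ : Set (BondConfig (Fin n))) := measureReal_mono inter_subset_right
      _ = 1 - μ.real (openConn o b) := probReal_compl_eq_one_sub (hmeas _)
      _ ≤ t := by linarith [hτ o ho]
  by_cases hob : o = b
  · subst hob
    have : ((⋃ a ∈ A, openConn o a) ∩ (openConn o o)ᶜ : Set (BondConfig (Fin n))) = ∅ := by
      ext ω
      simp only [mem_inter_iff, mem_compl_iff, mem_empty_iff_false, iff_false, not_and, not_not]
      exact fun _ => SimpleGraph.Reachable.refl o
    rw [this]; simp [ht]
  have hA3 : A.card = 3 := by omega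
  obtain ⟨d, hdA, rW, hrW, hcW, hker⟩ := hML n w A o b (1 - t) ho hb hob hA3 hτ
  set Wc : Finset (Fin n) → Set (Fin n) := fun W => ((↑W : Set (Fin n))ᶜ) with hWc
  set β : Finset (Fin n) → ℝ := fun W =>
    ∑ a ∈ A \ W, μ.real (openConnIn (Wc W) o a ∩ ⋂ a' ∈ (A \ W).filter (fun a' => rW W a' < rW W a), (openConnIn (Wc W) o a')ᶜ) *
      (1 - μ.real (openConnIn (Wc W) a b)) with hβdef
  have hβ : ∀ W : Finset (Fin n), o ∉ W → b ∉ W → d ∈ W →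
      μ.real ((⋃ a ∈ A \ W, openConnIn (Wc W) o a) ∩ (openConnIn (Wc W) o b)ᶜ) ≤ β W := by
    intro W hoW hbW hdW
    have hcard : (A \ W).card ≤ 2 := by
      have : (A \ W).card < A.card := Finset.card_lt_card ⟨Finset.sdiff_subset, fun h => (Finset.mem_sdiff.1 (h hdA)).2 hdW⟩
      omega
    have hcomp : ∀ a ∈ A \ W, ∀ a' ∈ A \ W, rW W a < rW W a' →
        (prodBernoulli (restrW (Wc W) w)).real (openConn a b) ≤ (prodBernoulli (restrW (Wc W) w)).real (openConn a' b) := by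
      intro a ha a' ha' h
      rw [hWc, restr_real_openConn w W (Finset.mem_sdiff.1 ha).2 b, restr_real_openConn w W (Finset.mem_sdiff.1 ha').2 b]
      exact hcW W a ha a' ha' h
    have hres := AGloc.agloc_firstRank_card_le_two (restrW (Wc W) w) (A \ W) o b (rW W) hcard (hrW W) hcomp
    rw [hWc, restr_real_fail w W (A \ W) hoW b] at hres
    refine hres.trans (le_of_eq ?_)
    refine Finset.sum_congr rfl fun a ha => ?_
    rw [restr_real_firstPat w W _ hoW a, restr_real_openConn w W (Finset.mem_sdiff.1 ha).2 b]
  have hpeel := peel_bound w A o b d β hβ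
  have hsplit : ∑ W ∈ Finset.univ.filter (fun W : Finset (Fin n) => o ∉ W ∧ b ∉ W), μ.real (clusterIs d W) * (1 - β W) =
      μ.real ((openConn d o)ᶜ ∩ (openConn d b)ᶜ : Set (BondConfig (Fin n)))
        - ∑ W ∈ Finset.univ.filter (fun W : Finset (Fin n) => o ∉ W ∧ b ∉ W), μ.real (clusterIs d W) * β W := by
    rw [← sum_clusterIs_filter_eq w o b d, ← Finset.sum_sub_distrib]
    refine Finset.sum_congr rfl fun W _ => ?_
    ring
  have hdb : 1 - μ.real (openConn d b) =
      μ.real (openConn d o ∩ (openConn d b)ᶜ : Set (BondConfig (Fin n))) + μ.real ((openConn d o)ᶜ ∩ (openConn d b)ᶜ : Set (BondConfig (Fin n))) := by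
    rw [← probReal_compl_eq_one_sub (hmeas _), ← measureReal_union (μ := μ) _ (hmeas _)]
    · congr 1
      ext ω
      simp only [mem_compl_iff, mem_union, mem_inter_iff]
      tauto
    · exact Set.disjoint_left.2 fun ω h1 h2 => h2.1 h1.1
  rw [hsplit] at hpeel
  linarith

/-- **(MU-loc)(3) ⇒ `AdditiveGluing` for every relay set with `|A| ≤ 3`** — the three-relay case of the crux from ONE peeling inequality (most useful instance:
`d` = the most-attached relay, the designation that survives every census).  (`b ∈ A`: `{o ↔ A} ⊆ {o ↔ b} ∪ {o ↔ A∖b, o ↮ b}` and the failure form on `A ∖ b`.)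
[cite: KozmaNitzan2024, §3.2 p. 12, Thm. 1 pp. 7–8, Conj. 1 p. 3] -/
theorem additiveGluing_card_three_of_muLoc
    (hML : ∀ (n : ℕ) (w : Sym2 (Fin n) → unitInterval) (A : Finset (Fin n)) (o b : Fin n) (θ : ℝ),
      o ∉ A → b ∉ A → o ≠ b → A.card = 3 → (∀ a ∈ A, θ ≤ (prodBernoulli w).real (openConn a b)) →
      ∃ d ∈ A, ∃ rW : Finset (Fin n) → (Fin n → ℕ),
        (∀ W : Finset (Fin n), Set.InjOn (rW W) ↑(A \ W)) ∧
        (∀ W : Finset (Fin n), ∀ a ∈ A \ W, ∀ a' ∈ A \ W, rW W a < rW W a' →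
          (prodBernoulli w).real (openConnIn ((↑W : Set (Fin n))ᶜ) a b) ≤ (prodBernoulli w).real (openConnIn ((↑W : Set (Fin n))ᶜ) a' b)) ∧
        (prodBernoulli w).real (openConn d o ∩ (openConn d b)ᶜ : Set (BondConfig (Fin n)))
          + (prodBernoulli w).real (openConn d b ∩ (openConn d o)ᶜ ∩ (⋃ a ∈ A.erase d, openConn o a))
          + ∑ W ∈ Finset.univ.filter (fun W : Finset (Fin n) => o ∉ W ∧ b ∉ W),
              (prodBernoulli w).real (clusterIs d W) *
                ∑ a ∈ A \ W, (prodBernoulli w).real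
                    (openConnIn ((↑W : Set (Fin n))ᶜ) o a ∩
                      ⋂ a' ∈ (A \ W).filter (fun a' => rW W a' < rW W a), (openConnIn ((↑W : Set (Fin n))ᶜ) o a')ᶜ) *
                  (1 - (prodBernoulli w).real (openConnIn ((↑W : Set (Fin n))ᶜ) a b))
          + θ ≤ 1) :
    ∀ (n : ℕ) (w : Sym2 (Fin n) → unitInterval) (A : Finset (Fin n)) (o b : Fin n) (t : ℝ), A.card ≤ 3 → 0 ≤ t →
      (∀ a ∈ A, 1 - t ≤ (prodBernoulli w).real (openConn a b)) →
      (prodBernoulli w).real (⋃ a ∈ A, openConn o a) - t ≤ (prodBernoulli w).real (openConn o b) := by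
  intro n w A o b t hA ht hτ
  set A' : Finset (Fin n) := A.erase b with hA'
  have hbA' : b ∉ A' := Finset.notMem_erase b A
  have hτ' : ∀ a ∈ A', 1 - t ≤ (prodBernoulli w).real (openConn a b) := fun a ha => hτ a (Finset.mem_of_mem_erase ha)
  have hcard : A'.card ≤ 3 := (Finset.card_le_card (Finset.erase_subset b A)).trans hA
  have hfail := agFail_card_three_of_muLoc hML n w A' o b t hcard hbA' ht hτ'
  have hsub : ((⋃ a ∈ A, openConn o a) : Set (BondConfig (Fin n))) ⊆
      openConn o b ∪ ((⋃ a ∈ A', openConn o a) ∩ (openConn o b)ᶜ) := by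
    intro ω hω
    by_cases hob : ω ∈ (openConn o b : Set (BondConfig (Fin n)))
    · exact Or.inl hob
    · refine Or.inr ⟨?_, hob⟩
      simp only [mem_iUnion, exists_prop] at hω ⊢
      obtain ⟨a, haA, hoa⟩ := hω
      refine ⟨a, Finset.mem_erase.2 ⟨?_, haA⟩, hoa⟩
      rintro rfl
      exact hob hoa
  calc (prodBernoulli w).real (⋃ a ∈ A, openConn o a) - t
      ≤ (prodBernoulli w).real (openConn o b ∪ ((⋃ a ∈ A', openConn o a) ∩ (openConn o b)ᶜ)) - t := by
        linarith [measureReal_mono (μ := prodBernoulli w) hsub]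
    _ ≤ (prodBernoulli w).real (openConn o b) + (prodBernoulli w).real ((⋃ a ∈ A', openConn o a) ∩ (openConn o b)ᶜ) - t := by
        linarith [measureReal_union_le (μ := prodBernoulli w) (openConn o b : Set (BondConfig (Fin n)))
          ((⋃ a ∈ A', openConn o a) ∩ (openConn o b)ᶜ)]
    _ ≤ (prodBernoulli w).real (openConn o b) := by linarith

end ClusterPeelMuLoc

end

end Summit.CriticalPhenomena.PercolationContinuityZ3.Theorems
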